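import Summits.BirchSwinnertonDyer.BirchSwinnertonDyer.Theorems.PrintCf2SplitBadTwoKummerTowerProNullAtV
import Summits.BirchSwinnertonDyer.BirchSwinnertonDyer.Theorems.PrintCf2SplitBadTwoKummerULocalPowers
import Summits.BirchSwinnertonDyer.BirchSwinnertonDyer.Theorems.PrintCf2SplitBadTwoKummerUUnramifiedValuation
import Literature.NumberTheory.GaloisRepresentations.IntegralGaloisActionProofs
import Literature.NumberTheory.GaloisRepresentations.DecompositionGroupOfCompletion
import HarnessLib

/-!
# Crux `PrintCf2.SplitBadTwoRankOneOfFacts` (stmt-BirchSwinnertonDyer-20368), S3n′-FACT-FREE road, R2 brick B4d: ASSEMBLY —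
# (PRO-NULL) of the `v`-adic Kummer tower in `Γ_K`-INTERNAL («U»-) currency: R1 (p696581) with every hypothesis read on
# `U = Gal(K̄/F) ≤ Γ_K`, the decomposition groups `σ⁻¹D_vσ` and the inertia groups of the primes of `\bar ℤ_K`

Cell `bsd-print-cf2`, EXTRA WIDTH seat `bsd-line-cf2-p1-w3` g13 (prover-bsd-line-cf2-p1-w3-g13-0); `--supports stmt-BirchSwinnertonDyer-20368`
(helper, Theses-free). HONEST FRAMING: nothing here closes the crux or a registered stub; BSD is not proved by any of this; no summit
statement is proved by this seat. No definition, no named fact, no `sorry`. UNCONDITIONAL (Leopoldt-at-`v` = Baker–Brumer is a theorem of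
the tree, through R1).

WHAT (memos `S3N-FACTFREE-w2g14.md` §3/§7, `R2-BRICKS` (-w5 g7) §3 B4). R1 = `KummerProNull.exists_level_forall_exists_pow_eq_of_local`
(p696581): `K` imaginary quadratic, `p = v·v̄`, `F ⊆ K̄` finite abelian over `K`; ∀ k ∃ M ≥ k: `x ∈ Fˣ` with `p^M ∣ ord_{w′}(x)` at every
`w′ ∤ v` and `x ∈ (F_{w′}ˣ)^{p^M}` at every `w′ ∣ v` is a `p^k`-th power in `F`. The Shapiro/Mackey reading (B2, -w5 g7) of the dual Selmer
condition produces these hypotheses on the SUBGROUP `U = galFixing K F ≤ Γ_K` for the Kummer cocycle `τ ↦ τβ/β` (`β^{p^M} = x`): a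
coboundary on `U ∩ σ⁻¹D_vσ` (strict above `v`), on `U ∩ I_𝔓` for the primes `𝔓` of `\bar ℤ_K` off `v, v̄` (unramified), and — at `v̄`,
where the dual condition is the annihilator of the unramified classes — the divisibility `p^M ∣ ord_{w′}(x)` itself (B5). With the coboundaries
absorbed into the root (`τβ/β = τζ/ζ ⟺ τ` fixes `β/ζ`; -w6 g6's model-free (P-A)), THIS FILE assembles:
* `exists_level_forall_exists_pow_eq_of_galois` — **(PRO-NULL)_U, root form**: ∀ k ∃ M ≥ k ∀ x ∈ Fˣ,
  [∀ σ, some `p^M`-th root of `x` is fixed by `{τ ∈ U : στσ⁻¹ ∈ D_v}`] → [∀ primes `𝔓` of `\bar ℤ_K` not above `v` or `v̄`, some `p^M`-th root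
  of `x` is fixed by `U ∩ I_𝔓`] → [∀ `w′ ∣ v̄`, `p^M ∣ ord_{w′}(x)`] → `∃ y ∈ F, y^{p^k} = x`
  (B4c `KummerU.exists_pow_eq_adicCompletion_of_forall_exists_root_fixed` at `v`, B4b `KummerU.dvd_log_valuation_of_galFixing_inter_inertia_
  fixes_root` off `v, v̄` — a prime of `\bar ℤ_K` above each place of `F` by `Ideal.exists_ideal_over_prime_of_isIntegral_of_isDomain` — then R1);
* `exists_level_forall_exists_pow_eq_of_galois'` — the same with (unr) in the `(w, σ)`-form of the line's formalism: for every place `w ∉ {v, v̄}`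
  of `K` and every `σ ∈ Γ_K`, some `p^M`-th root of `x` is fixed by `{τ ∈ U : στσ⁻¹ ∈ I_w}` (`I_w = GreenbergSelmer.inertia w`, the inertia group
  of the chosen prime `𝔓₀(w) = adicCompletionPrime K w`); reduced to the prime form by transitivity of `Γ_K` on the primes above `w`
  (`exists_smul_eq_of_mem_primesAbove_holds`) and `I_{σ𝔓₀} = σI_wσ⁻¹` (`mem_inertia_pointwise_smul_iff`, `inertia_adicCompletionPrime_eq_map_absInertia`);
* `exists_pow_eq_mul_of_pow_eq_pow` / `kummerCocycle_pow_eq_of_pow_eq` — the conclusion read back on the cocycle: `β^{p^M} = x = y^{p^k}` ⟹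
  `β^{p^{M−k}} = y·ζ` with `ζ^{p^k} = 1`, so the cocycle of `β` pushed along `μ_{p^M} → μ_{p^k}` (`ζ ↦ ζ^{p^{M−k}}`) is the coboundary of `ζ` on
  `U`: `(τβ/β)^{p^{M−k}} = τζ/ζ` for every `τ` fixing `F` — «`H¹(j^D) y = 0`» at cocycle level, model-free.
presearch: Greenberg LNM 1716 §4 Props 4.13–4.15, GV2000 §2; de Shalit III.2.3 (Leopoldt for F/K abelian); Serre Local Fields X §3 b) — assembly of
tree facts, no new fact. beyond-print theorem: no.

References: [deShalit1987] III.2.3; [SerreLocalFields1979] X §3 b), I §7 Prop. 22 (b); [GreenbergLNM1716] §4 Props. 4.13–4.15; [NeukirchANT1999]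
Ch. II (8.2)–(8.3).
-/

noncomputable section

set_option linter.dupNamespace false
set_option autoImplicit false

open scoped Classical Pointwise
open NumberField IsDedekindDomain Field IntermediateField
open Literature.NumberTheory.EllipticCurves Literature.NumberTheory.EllipticCurves.GreenbergSelmer
open Literature.NumberTheory.GaloisRepresentations Literature.NumberTheory.GaloisRepresentations.LocalWeilDatum

namespace Summit.BirchSwinnertonDyer.BirchSwinnertonDyer.Theorems.PrintCf2.KummerU

/-! ## §1. Pure algebra: reading `x = y^{p^k}` back on the Kummer cocycle of a `p^M`-th root -/

section Algebra

variable {Ω : Type*} [Field Ω]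

/-- If `β^{p^M} = y^{p^k}` with `y ≠ 0` and `k ≤ M`, then `β^{p^{M−k}} = y·ζ` for a `p^k`-th root of unity `ζ`. [folklore] -/
theorem exists_pow_eq_mul_of_pow_eq_pow {p M k : ℕ} (hkM : k ≤ M) {β y : Ω} (hy : y ≠ 0) (h : β ^ p ^ M = y ^ p ^ k) :
    ∃ ζ : Ω, ζ ^ p ^ k = 1 ∧ β ^ p ^ (M - k) = y * ζ := by
  refine ⟨β ^ p ^ (M - k) / y, ?_, ?_⟩
  · rw [div_pow, ← pow_mul, ← pow_add, Nat.sub_add_cancel hkM, h, div_self (pow_ne_zero _ hy)]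
  · rw [mul_div_cancel₀ _ hy]

variable {G : Type*} [Group G] [MulSemiringAction G Ω]

/-- **The pushed Kummer cocycle is a coboundary.** If `β^{p^M} = y^{p^k}` (`k ≤ M`, `y ≠ 0`) and `g` fixes `y`, then
`(g•β/β)^{p^{M−k}} = g•ζ/ζ` for the root of unity `ζ = β^{p^{M−k}}/y` (`ζ^{p^k} = 1`): the Kummer cocycle of `β` pushed along
`μ_{p^M} → μ_{p^k}`, `ζ ↦ ζ^{p^{M−k}}`, is the coboundary of `ζ` on the group fixing `y`. [cite: SerreLocalFields1979, X §3 b)] -/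
theorem kummerCocycle_pow_eq_of_pow_eq {p M k : ℕ} (hp : 0 < p) (hkM : k ≤ M) {β y : Ω} (hy : y ≠ 0)
    (h : β ^ p ^ M = y ^ p ^ k) :
    ∃ ζ : Ω, ζ ^ p ^ k = 1 ∧ ζ ≠ 0 ∧ ∀ g : G, g • y = y → (g • β / β) ^ p ^ (M - k) = g • ζ / ζ := by
  obtain ⟨ζ, hζ, hβ⟩ := exists_pow_eq_mul_of_pow_eq_pow hkM hy h
  have hζ0 : ζ ≠ 0 := by
    intro h0
    rw [h0, zero_pow (pow_ne_zero _ hp.ne')] at hζ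
    exact zero_ne_one hζ
  refine ⟨ζ, hζ, hζ0, fun g hg ↦ ?_⟩
  rw [div_pow, ← smul_pow', hβ, smul_mul', hg, mul_div_mul_left _ _ hy]

end Algebra

/-! ## §2. (PRO-NULL) of the `v`-adic Kummer tower, `Γ_K`-internal («U»-) currency -/

section ProNull

variable {K : Type} [Field K] [NumberField K] {p : ℕ} [Fact p.Prime]

omit [NumberField K] in
/-- A prime of `\bar ℤ_K = absIntegers (𝓞 K) K` above any finite place `w′` of a finite `F ⊆ K̄` (lying over along
`ringOfIntegersToIntegralClosure F : 𝓞 F → \bar ℤ_K`; `\bar ℤ_K` is integral over `𝓞 F`). [cite: NeukirchANT1999, Ch. I §9 (going up)] -/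
theorem exists_prime_absIntegers_comap_eq (F : IntermediateField K (AlgebraicClosure K)) [NumberField F]
    (w' : HeightOneSpectrum (𝓞 F)) :
    ∃ 𝔓 : Ideal (absIntegers (𝓞 K) K), 𝔓.IsPrime ∧
      𝔓.comap (ringOfIntegersToIntegralClosure (k := K) (Ω := AlgebraicClosure K) F) = w'.asIdeal := by
  letI : Algebra (𝓞 F) (absIntegers (𝓞 K) K) :=
    (ringOfIntegersToIntegralClosure (k := K) (Ω := AlgebraicClosure K) F).toAlgebra
  haveI : IsScalarTower (𝓞 K) (𝓞 F) (absIntegers (𝓞 K) K) :=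
    IsScalarTower.of_algebraMap_eq' (ringOfIntegersToIntegralClosure_comp_algebraMap
      (k := K) (Ω := AlgebraicClosure K) F).symm
  haveI : Algebra.IsIntegral (𝓞 F) (absIntegers (𝓞 K) K) := Algebra.IsIntegral.tower_top (R := 𝓞 K)
  haveI := w'.isPrime
  have hker : RingHom.ker (algebraMap (𝓞 F) (absIntegers (𝓞 K) K)) ≤ w'.asIdeal := by
    change RingHom.ker (ringOfIntegersToIntegralClosure (k := K) (Ω := AlgebraicClosure K) F) ≤ w'.asIdeal
    rw [(RingHom.injective_iff_ker_eq_bot _).1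
      (ringOfIntegersToIntegralClosure_injective (k := K) (Ω := AlgebraicClosure K) F)]
    exact bot_le
  obtain ⟨𝔓, h𝔓, h⟩ := Ideal.exists_ideal_over_prime_of_isIntegral_of_isDomain
    (S := absIntegers (𝓞 K) K) w'.asIdeal hker
  exact ⟨𝔓, h𝔓, h⟩

omit [NumberField K] in
/-- The place of `K` below a prime `𝔓` of `\bar ℤ_K` lying over the place `w′` of `F` is the place of `K` below `w′`. [folklore] -/
theorem comap_algebraMap_eq_under_of_comap_eq (F : IntermediateField K (AlgebraicClosure K)) [NumberField F]
    {w' : HeightOneSpectrum (𝓞 F)} {𝔓 : Ideal (absIntegers (𝓞 K) K)}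
    (h : 𝔓.comap (ringOfIntegersToIntegralClosure (k := K) (Ω := AlgebraicClosure K) F) = w'.asIdeal) :
    𝔓.comap (algebraMap (𝓞 K) (absIntegers (𝓞 K) K)) = w'.asIdeal.under (𝓞 K) := by
  ext r
  have hr : algebraMap (𝓞 K) (absIntegers (𝓞 K) K) r =
      ringOfIntegersToIntegralClosure (k := K) (Ω := AlgebraicClosure K) F (algebraMap (𝓞 K) (𝓞 F) r) :=
    (RingHom.congr_fun (ringOfIntegersToIntegralClosure_comp_algebraMap (k := K) (Ω := AlgebraicClosure K) F) r).symm
  rw [Ideal.mem_comap, hr, Ideal.under_def, Ideal.mem_comap, ← h, Ideal.mem_comap]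
  exact Iff.rfl

/-- **(PRO-NULL) of the `v`-adic Kummer tower of `𝔾_m` over an abelian extension `F` of an imaginary quadratic `K`, in `Γ_K`-internal
currency, root form.** For every `k` there is `M ≥ k` such that every `x ∈ Fˣ` satisfying
(v) for every `σ ∈ Γ_K`, some `p^M`-th root of `x` in `K̄` is fixed by `{τ ∈ Gal(K̄/F) : στσ⁻¹ ∈ D_v}` («the Kummer class of `x` is locally
    trivial at every place of `F` above `v`»),
(unr) for every place `w ∉ {v, v̄}` of `K` and every prime `𝔓` of `\bar ℤ_K` above `w`, some `p^M`-th root of `x` is fixed by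
    `Gal(K̄/F) ∩ I_𝔓` («unramified away from `p`»), and
(v̄) `p^M ∣ ord_{w′}(x)` at every place `w′` of `F` above `v̄` (the annihilator-of-unramified condition, B5),
is a `p^k`-th power in `F`. (= R1 `KummerProNull.exists_level_forall_exists_pow_eq_of_local` ∘ B4c ∘ B4b.)
[cite: deShalit1987, III.2.3 (Theorem (Baker–Brumer))] [cite: SerreLocalFields1979, X §3 b)] [cite: SilvermanAEC2009, Prop. VIII.1.6 (proof)] -/
theorem exists_level_forall_exists_pow_eq_of_galois (hK : IsImaginaryQuadratic K) {v vbar : HeightOneSpectrum (𝓞 K)}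
    (hv : ((p : ℕ) : 𝓞 K) ∈ v.asIdeal) (hvbar : ((p : ℕ) : 𝓞 K) ∈ vbar.asIdeal) (hne : vbar ≠ v)
    (F : IntermediateField K (AlgebraicClosure K)) [FiniteDimensional K F] [IsAbelianGalois K F] [NumberField F] (k : ℕ) :
    ∃ M : ℕ, k ≤ M ∧ ∀ x : F, x ≠ 0 →
      (∀ σ : absoluteGaloisGroup K, ∃ β : AlgebraicClosure K, β ^ p ^ M = ((x : F) : AlgebraicClosure K) ∧
        ∀ τ : absoluteGaloisGroup K, τ ∈ galFixing K F → σ * τ * σ⁻¹ ∈ decomp v → τ • β = β) →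
      (∀ w : HeightOneSpectrum (𝓞 K), w ≠ v → w ≠ vbar → ∀ 𝔓 ∈ w.primesAbove,
        ∃ β : AlgebraicClosure K, β ^ p ^ M = ((x : F) : AlgebraicClosure K) ∧
          ∀ τ : absoluteGaloisGroup K, τ ∈ galFixing K F → τ ∈ 𝔓.inertia (absoluteGaloisGroup K) → τ • β = β) →
      (∀ w' : vbar.Extension (𝓞 F), ((p ^ M : ℕ) : ℤ) ∣ WithZero.log (w'.1.valuation F x)) →
      ∃ y : F, y ^ p ^ k = x := by
  have hp : p.Prime := Fact.out
  obtain ⟨M, hkM, hM⟩ := KummerProNull.exists_level_forall_exists_pow_eq_of_local (p := p) hK hv hvbar hne F k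
  refine ⟨M, hkM, fun x hx hloc hunr hbar ↦ hM x hx (fun w' hw' ↦ ?_) (fun w' ↦ ?_)⟩
  · -- away from `v`: either above `v̄` (hypothesis (v̄)) or off `p` (B4b at a prime of `\bar ℤ_K` above `w′`)
    by_cases hwbar : w'.under (𝓞 K) = vbar
    · exact hbar ⟨w', hwbar⟩
    · obtain ⟨𝔓, h𝔓, h𝔓w⟩ := exists_prime_absIntegers_comap_eq F w'
      haveI := h𝔓
      have hunder := comap_algebraMap_eq_under_of_comap_eq F h𝔓w
      have hmem : 𝔓 ∈ (w'.under (𝓞 K)).primesAbove :=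
        HeightOneSpectrum.mem_primesAbove_iff.2 ⟨h𝔓, ⟨hunder.symm⟩⟩
      obtain ⟨β, hβ, hτ⟩ := hunr (w'.under (𝓞 K)) hw' hwbar 𝔓 hmem
      exact_mod_cast dvd_log_valuation_of_galFixing_inter_inertia_fixes_root F (pow_pos hp.pos M) hβ w' 𝔓 h𝔓w hτ
  · -- above `v`: B4c
    exact exists_pow_eq_adicCompletion_of_forall_exists_root_fixed F v (p ^ M) x hloc w'

end ProNull

/-! ## §3. The `(w, σ)`-form: inertia groups of the chosen primes, conjugated -/

section Conj

variable {K : Type} [Field K] [NumberField K] {p : ℕ} [Fact p.Prime]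

omit [NumberField K] [Fact p.Prime] in
/-- Inertia of a translated prime: `τ ∈ I_{σ𝔓} ↔ σ⁻¹τσ ∈ I_𝔓` (any group acting on a ring by ring automorphisms).
[cite: NeukirchANT1999, Ch. I §9 (9.4)] -/
theorem mem_inertia_pointwise_smul_iff {G B : Type*} [Group G] [CommRing B] [MulSemiringAction G B]
    (𝔓 : Ideal B) (σ τ : G) : τ ∈ (σ • 𝔓).inertia G ↔ σ⁻¹ * τ * σ ∈ 𝔓.inertia G := by
  rw [Ideal.inertia, Ideal.inertia, AddSubgroup.mem_inertia, AddSubgroup.mem_inertia]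
  constructor
  · intro h b
    have hb := h (σ • b)
    rw [Submodule.mem_toAddSubgroup, Ideal.mem_pointwise_smul_iff_inv_smul_mem, smul_sub, inv_smul_smul,
      ← mul_smul, ← mul_smul] at hb
    exact hb
  · intro h b
    have hb := h (σ⁻¹ • b)
    rw [Submodule.mem_toAddSubgroup, mul_smul, mul_smul, smul_inv_smul] at hb
    rw [Submodule.mem_toAddSubgroup, Ideal.mem_pointwise_smul_iff_inv_smul_mem, smul_sub]
    exact hb

/-- **From the `(w, σ)`-form to the prime form.** If for every `σ ∈ Γ_K` some `n`-th root of `x` is fixed by `{τ ∈ U : στσ⁻¹ ∈ I_w}`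
(`I_w = GreenbergSelmer.inertia w`), then for every prime `𝔓` of `\bar ℤ_K` above `w` some `n`-th root of `x` is fixed by `U ∩ I_𝔓`
(transitivity of `Γ_K` on the primes above `w`; `I_{σ𝔓₀} = σ I_w σ⁻¹`). [cite: NeukirchANT1999, Ch. I §9 Prop. (9.1), Ch. II §9 Prop. (9.6)] -/
theorem forall_primesAbove_exists_root_fixed_of_forall_conj (U : Subgroup (absoluteGaloisGroup K))
    (w : HeightOneSpectrum (𝓞 K)) {n : ℕ} {x : AlgebraicClosure K}
    (h : ∀ σ : absoluteGaloisGroup K, ∃ β : AlgebraicClosure K, β ^ n = x ∧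
      ∀ τ : absoluteGaloisGroup K, τ ∈ U → σ * τ * σ⁻¹ ∈ GreenbergSelmer.inertia w → τ • β = β)
    (𝔓 : Ideal (absIntegers (𝓞 K) K)) (h𝔓 : 𝔓 ∈ w.primesAbove) :
    ∃ β : AlgebraicClosure K, β ^ n = x ∧
      ∀ τ : absoluteGaloisGroup K, τ ∈ U → τ ∈ 𝔓.inertia (absoluteGaloisGroup K) → τ • β = β := by
  obtain ⟨σ, hσ⟩ := HeightOneSpectrum.exists_smul_eq_of_mem_primesAbove_holds (K := K) (v := w)
    (adicCompletionPrime_mem_primesAbove K w) h𝔓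
  have hI : GreenbergSelmer.inertia w = (adicCompletionPrime K w).inertia (absoluteGaloisGroup K) :=
    (inertia_adicCompletionPrime_eq_map_absInertia K w).symm
  obtain ⟨β, hβ, hτ⟩ := h σ⁻¹
  refine ⟨β, hβ, fun τ hτU hτI ↦ hτ τ hτU ?_⟩
  rw [hI, ← hσ] at *
  rw [inv_inv]
  exact (mem_inertia_pointwise_smul_iff (adicCompletionPrime K w) σ τ).1 hτI

/-- **(PRO-NULL) of the `v`-adic Kummer tower, `Γ_K`-internal currency, `(w, σ)`-form.** As `exists_level_forall_exists_pow_eq_of_galois`, with the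
unramified hypothesis stated on the conjugates of the chosen inertia groups `I_w = GreenbergSelmer.inertia w` (`w ∉ {v, v̄}`), the form in which the
Shapiro–Mackey reading of the dual Selmer condition delivers it (`∀ σ, conjH1 U M σ y ∈ unramifiedKer U M w` at cocycle level, coboundary
absorbed into the root). [cite: deShalit1987, III.2.3 (Theorem (Baker–Brumer))] [cite: SerreLocalFields1979, X §3 b)]
[cite: SilvermanAEC2009, Prop. VIII.1.6 (proof)] -/
theorem exists_level_forall_exists_pow_eq_of_galois' (hK : IsImaginaryQuadratic K) {v vbar : HeightOneSpectrum (𝓞 K)}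
    (hv : ((p : ℕ) : 𝓞 K) ∈ v.asIdeal) (hvbar : ((p : ℕ) : 𝓞 K) ∈ vbar.asIdeal) (hne : vbar ≠ v)
    (F : IntermediateField K (AlgebraicClosure K)) [FiniteDimensional K F] [IsAbelianGalois K F] [NumberField F] (k : ℕ) :
    ∃ M : ℕ, k ≤ M ∧ ∀ x : F, x ≠ 0 →
      (∀ σ : absoluteGaloisGroup K, ∃ β : AlgebraicClosure K, β ^ p ^ M = ((x : F) : AlgebraicClosure K) ∧
        ∀ τ : absoluteGaloisGroup K, τ ∈ galFixing K F → σ * τ * σ⁻¹ ∈ decomp v → τ • β = β) →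
      (∀ w : HeightOneSpectrum (𝓞 K), w ≠ v → w ≠ vbar → ∀ σ : absoluteGaloisGroup K,
        ∃ β : AlgebraicClosure K, β ^ p ^ M = ((x : F) : AlgebraicClosure K) ∧
          ∀ τ : absoluteGaloisGroup K, τ ∈ galFixing K F → σ * τ * σ⁻¹ ∈ GreenbergSelmer.inertia w → τ • β = β) →
      (∀ w' : vbar.Extension (𝓞 F), ((p ^ M : ℕ) : ℤ) ∣ WithZero.log (w'.1.valuation F x)) →
      ∃ y : F, y ^ p ^ k = x := by
  obtain ⟨M, hkM, hM⟩ := exists_level_forall_exists_pow_eq_of_galois (p := p) hK hv hvbar hne F k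
  exact ⟨M, hkM, fun x hx hloc hunr hbar ↦ hM x hx hloc
    (fun w hwv hwvbar 𝔓 h𝔓 ↦ forall_primesAbove_exists_root_fixed_of_forall_conj (galFixing K F) w (hunr w hwv hwvbar) 𝔓 h𝔓)
    hbar⟩

end Conj

end Summit.BirchSwinnertonDyer.BirchSwinnertonDyer.Theorems.PrintCf2.KummerU

end
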